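import Literature.Combinatorics.SimpleGraph.TreeSubtreeLayerCount   -- ★ `TreeLayers.parent_eq_of_adj_of_height`, `card_children_eq_degree_sub_one`, `fin_two_eq_of_ne_of_ne` (F0P3a-p08 (g17))
import HarnessLib

/-!
# Layer counts above a HEREDITARY predicate: per-period layers around an infinite subtree (Serre, *Trees* I.2.3, I.6.4)

Topic `Combinatorics/SimpleGraph`; namespace `Literature.Combinatorics.SimpleGraph.TreeLayers` (same as ★ `TreeSubtreeLayerCount`, which this file extends).  THEOREMS ONLY
(no definition, no instance, no notation, no named fact, no `sorry`); arbitrary vertex type, `G` locally finite.  Cell `pub/hodgecm-mathlib`, F0∕P3a, crux H413 =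
`stmt-HodgeConjecture-24833`, line «N6nsGerm», residue `stub_N6nsS3id`, road «S3-tree» (deal sheet = CENSUS «S3» v3, architect A-p16 (g28); «tree organs» hand F0P3a-p08 (g17)).
MOTIVATION (CENSUS-T2 75083796 (S4)∕(S2′), F0P2-p02 (g10)): for the SPLIT-RANK-ONE torus type the fixed set of a deep `γ` is a TUBE around the apartment `𝒜` — an infinite line
translated by `diag(ϖ, 1, ϖ⁻¹)` — so the sphere counts `C_k(γ)` of S3-W2 ∕ LAW L5 are taken PER PERIOD (A-p12 (g20): «fundamental domain of the translation»).  We avoid quotients: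
a predicate `P` on vertices HEREDITARY along the parent map of ★ `exists_retraction` (`P w ↔ P (p w)` off `Y`; e.g. `P v :=` «the root `p^{h v} v` lies in a fundamental domain `D`»,
`iterate_parent_hereditary`) cuts every layer, the restricted layers `L_k ∩ P` are finite as soon as `Y ∩ P` is, and they obey the SAME recursions as in ★ `TreeSubtreeLayerCount`.
HONEST LABEL: HC_CM is proved only modulo the printed citations (the 2 remaining named inputs hLiu418, h413) until rung 0 closes; pure graph theory here.

* **`exists_finset_layer_succ_of_hereditary`** — `L_{k+1} ∩ P = ⊔_{v ∈ L_k ∩ P} children(v)` (Finset form, with cardinality);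
* **`finite_layer_of_hereditary`** — `Y ∩ P` finite ⇒ every `L_k ∩ P` finite;
* **`ncard_layer_succ_inter_type_eq_of_hereditary`** — the restricted two-type recursion `#(L_{k+1} ∩ c⁻¹{i} ∩ P) = q j · #(L_k ∩ c⁻¹{j} ∩ P)` (`k ≥ 1`, `i ≠ j`);
* **`iterate_parent_hereditary`** — the root predicate `p^[h v] v ∈ D` is hereditary.

## References
* [Serre1980Trees] J.-P. Serre, *Trees*, Springer (1980): I.2.3 (projection onto a subtree), I.6.4 Prop. 24–25 (translations and their axes; per-period counting).
* [Diestel2010] R. Diestel, *Graph Theory*, 4th ed., Thm. 1.5.1.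
-/

set_option autoImplicit false

open SimpleGraph Finset

namespace Literature.Combinatorics.SimpleGraph.TreeLayers

variable {V : Type*} {G : SimpleGraph V} [G.LocallyFinite]

/-! ## §1 Layers above a hereditary predicate

For the split-rank-one torus type of road «S3-tree» (CENSUS-T2 (S4): `Fix γ` is a TUBE around the
apartment, an infinite line translated by `diag(ϖ,1,ϖ⁻¹)`; counts are taken PER PERIOD) the subtree `Y` is infinite, but the layers above a FUNDAMENTAL DOMAIN `D ⊆ Y` are finite.
We phrase this without quotients: a predicate `P` on vertices that is HEREDITARY along the parent map (`P w ↔ P (p w)` off `Y`; e.g. `P v :=` «the root `p^{h v} v` of `v` lies in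
`D`») cuts every layer, and the restricted layers `L_k ∩ P` obey the same recursions, with finiteness inherited from `Y ∩ P`. -/

section Hereditary

variable {Y : Set V} {h : V → ℕ} {p : V → V}
  (h0 : ∀ v, h v = 0 ↔ v ∈ Y) (hpar : ∀ v, v ∉ Y → G.Adj v (p v) ∧ h (p v) + 1 = h v)
  (hchild : ∀ v w, v ∉ Y → G.Adj v w → w ≠ p v → h w = h v + 1 ∧ p w = v)
  {P : V → Prop} (hP : ∀ w, w ∉ Y → (P w ↔ P (p w)))

include h0 hpar hchild hP in
/-- **The restricted layer recursion (Finset form)**: if `L_k ∩ P` is the finite set `s`, then `L_{k+1} ∩ P` is `s.biUnion children` (children inherit `P` from their parent), and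
`#(L_{k+1} ∩ P) = Σ_{v ∈ L_k ∩ P} #children(v)`. [cite: Serre1980Trees, I.2.3] -/
theorem exists_finset_layer_succ_of_hereditary [DecidableEq V] {k : ℕ} {s : Finset V} (hs : ∀ v, v ∈ s ↔ h v = k ∧ P v) :
    ∃ t : Finset V, (∀ w, w ∈ t ↔ h w = k + 1 ∧ P w) ∧ t.card = ∑ v ∈ s, ((G.neighborFinset v).filter (fun w => h w = h v + 1)).card := by
  refine ⟨s.biUnion (fun v => (G.neighborFinset v).filter (fun w => h w = h v + 1)), fun w => ?_, ?_⟩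
  · rw [mem_biUnion]
    constructor
    · rintro ⟨v, hv, hw⟩
      rw [mem_filter, mem_neighborFinset] at hw
      obtain ⟨hvk, hvP⟩ := (hs v).1 hv
      have hwY : w ∉ Y := fun hY => by have := (h0 w).2 hY; omega
      have hpw : p w = v := parent_eq_of_adj_of_height hchild hwY hw.1.symm hw.2
      exact ⟨by rw [hw.2, hvk], (hP w hwY).2 (by rw [hpw]; exact hvP)⟩
    · rintro ⟨hw, hwP⟩
      have hwY : w ∉ Y := fun hY => by have := (h0 w).2 hY; omega
      obtain ⟨hadj, hh⟩ := hpar w hwY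
      refine ⟨p w, (hs (p w)).2 ⟨by omega, (hP w hwY).1 hwP⟩, ?_⟩
      rw [mem_filter, mem_neighborFinset]
      exact ⟨hadj.symm, by omega⟩
  · apply card_biUnion
    intro v hv v' hv' hne
    rw [Function.onFun, Finset.disjoint_left]
    intro w hw hw'
    rw [mem_filter, mem_neighborFinset] at hw hw'
    have hwY : w ∉ Y := fun hY => by
      have := (h0 w).2 hY
      have := ((hs v).1 hv).1
      omega
    have h1 : p w = v := parent_eq_of_adj_of_height hchild hwY hw.1.symm hw.2
    have h2 : p w = v' := parent_eq_of_adj_of_height hchild hwY hw'.1.symm hw'.2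
    exact hne (h1.symm.trans h2)

include h0 hpar hchild hP in
/-- **The restricted layers are finite when `Y ∩ P` is** (e.g. a finite fundamental domain of a translated apartment). [cite: Serre1980Trees, I.2.3] -/
theorem finite_layer_of_hereditary (hD : {v | v ∈ Y ∧ P v}.Finite) (k : ℕ) : {v | h v = k ∧ P v}.Finite := by
  classical
  induction k with
  | zero =>
    refine hD.subset fun v hv => ⟨(h0 v).1 hv.1, hv.2⟩
  | succ k ih =>
    obtain ⟨t, ht, -⟩ := exists_finset_layer_succ_of_hereditary h0 hpar hchild hP (s := ih.toFinset) (fun v => by rw [Set.Finite.mem_toFinset]; rfl)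
    refine t.finite_toSet.subset fun w hw => ?_
    rw [Finset.mem_coe, ht]
    exact hw

include h0 hpar hchild hP in
/-- **THE RESTRICTED TWO-TYPE RECURSION** (per period): with a type function `c` (adjacent vertices of different types), degrees `q (c v) + 1` off `Y`, a hereditary `P` with `Y ∩ P`
finite, `k ≥ 1` and `i ≠ j`: `#(L_{k+1} ∩ c⁻¹{i} ∩ P) = q j · #(L_k ∩ c⁻¹{j} ∩ P)`. [cite: Serre1980Trees, I.2.3] -/
theorem ncard_layer_succ_inter_type_eq_of_hereditary (hD : {v | v ∈ Y ∧ P v}.Finite) (c : V → Fin 2) (hc : ∀ v w, G.Adj v w → c v ≠ c w) (q : Fin 2 → ℕ)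
    (hdeg : ∀ v, v ∉ Y → G.degree v = q (c v) + 1) {i j : Fin 2} (hij : i ≠ j) {k : ℕ} (hk : 1 ≤ k) :
    {w | h w = k + 1 ∧ c w = i ∧ P w}.ncard = q j * {v | h v = k ∧ c v = j ∧ P v}.ncard := by
  classical
  have hfk := finite_layer_of_hereditary h0 hpar hchild hP hD k
  set s : Finset V := hfk.toFinset.filter (fun v => c v = j) with hsdef
  have hs : ∀ v, v ∈ s ↔ h v = k ∧ c v = j ∧ P v := fun v => by
    rw [hsdef, mem_filter, Set.Finite.mem_toFinset, Set.mem_setOf_eq]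
    tauto
  have hsj : {v | h v = k ∧ c v = j ∧ P v} = (s : Set V) := by
    ext v; rw [Set.mem_setOf_eq, Finset.mem_coe, hs]
  set t : Finset V := s.biUnion (fun v => (G.neighborFinset v).filter (fun w => h w = h v + 1)) with htdef
  have hother : ∀ v w, G.Adj v w → (c w = i ↔ c v = j) := by
    intro v w hadj
    have hne := hc v w hadj
    constructor
    · intro hwi
      exact fin_two_eq_of_ne_of_ne hij.symm (by rw [← hwi]; exact hne)
    · intro hvj
      exact fin_two_eq_of_ne_of_ne hij (by rw [← hvj]; exact fun heq => hne heq.symm)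
  have ht : ∀ w, w ∈ t ↔ h w = k + 1 ∧ c w = i ∧ P w := by
    intro w
    rw [htdef, mem_biUnion]
    constructor
    · rintro ⟨v, hv, hw⟩
      rw [mem_filter, mem_neighborFinset] at hw
      obtain ⟨hvk, hvj, hvP⟩ := (hs v).1 hv
      have hwY : w ∉ Y := fun hY' => by have := (h0 w).2 hY'; omega
      have hpw : p w = v := parent_eq_of_adj_of_height hchild hwY hw.1.symm hw.2
      exact ⟨by rw [hw.2, hvk], (hother v w hw.1).2 hvj, (hP w hwY).2 (by rw [hpw]; exact hvP)⟩
    · rintro ⟨hw, hwi, hwP⟩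
      have hwY : w ∉ Y := fun hY' => by have := (h0 w).2 hY'; omega
      obtain ⟨hadj, hh⟩ := hpar w hwY
      refine ⟨p w, (hs (p w)).2 ⟨by omega, (hother (p w) w hadj.symm).1 hwi, (hP w hwY).1 hwP⟩, ?_⟩
      rw [mem_filter, mem_neighborFinset]
      exact ⟨hadj.symm, by omega⟩
  have hti : {w | h w = k + 1 ∧ c w = i ∧ P w} = (t : Set V) := by
    ext w; rw [Set.mem_setOf_eq, Finset.mem_coe, ht]
  have hcard : t.card = ∑ v ∈ s, ((G.neighborFinset v).filter (fun w => h w = h v + 1)).card := by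
    apply card_biUnion
    intro v hv v' hv' hne
    rw [Function.onFun, Finset.disjoint_left]
    intro w hw hw'
    rw [mem_filter, mem_neighborFinset] at hw hw'
    have hwY : w ∉ Y := fun hY' => by
      have := (h0 w).2 hY'
      have := ((hs v).1 hv).1
      omega
    have h1 : p w = v := parent_eq_of_adj_of_height hchild hwY hw.1.symm hw.2
    have h2 : p w = v' := parent_eq_of_adj_of_height hchild hwY hw'.1.symm hw'.2
    exact hne (h1.symm.trans h2)
  rw [hti, hsj, Set.ncard_coe_finset, Set.ncard_coe_finset, hcard, mul_comm]
  refine Finset.sum_const_nat fun v hv => ?_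
  obtain ⟨hvk, hvj, -⟩ := (hs v).1 hv
  have hvY : v ∉ Y := fun hY' => by have := (h0 v).2 hY'; omega
  rw [card_children_eq_degree_sub_one hpar hchild hvY, hdeg v hvY, hvj, Nat.add_sub_cancel]

omit [G.LocallyFinite] in
include hpar in
/-- **The root predicate is hereditary**: for `D ⊆ V`, `P v := p^[h v] v ∈ D` satisfies `P w ↔ P (p w)` off `Y` (since `h w = h (p w) + 1` and `p^[n+1] w = p^[n] (p w)`). So the
theorems of this section apply to «the layers above a fundamental domain `D` of `Y`». [cite: Serre1980Trees, I.2.3] -/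
theorem iterate_parent_hereditary (D : Set V) {w : V} (hw : w ∉ Y) : p^[h w] w ∈ D ↔ p^[h (p w)] (p w) ∈ D := by
  rw [← (hpar w hw).2, Function.iterate_succ_apply]

end Hereditary


/-! ## §2 (ED. 2) The FIRST layer above a hereditary predicate; the cone below one vertex of `Y`

ED. 2 (F0P3a-p08 (g17), same day; previous declarations byte-identical).  Asked by architect A-p16 (g29) 16:03:09Z (iii) for T2-S (F0P2-p02 (g10)): the recursion of §1 starts at
`k ≥ 1`; the step `0 → 1` reads the BOUNDARY of `Y` — the children of `y ∈ Y` are `N(y) ∖ Y` (★ `children_eq_filter_not_mem`) — so `#(L_1 ∩ P) = Σ_{y ∈ Y ∩ P} #(N(y) ∖ Y)`, typed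
form `#(L_1 ∩ c⁻¹{i} ∩ P) = Σ_{y ∈ Y ∩ P, c y = j} #(N(y) ∖ Y)`, and for a single root (`Y ∩ P = {y₀}`, the CONE hanging off `y₀`) `#(L_1 ∩ P) = #(N(y₀) ∖ Y) = deg y₀ − #(N(y₀) ∩ Y)`
(`= deg y₀ − 2` for an inner vertex `y₀` of an axis `Y`: the «`(deg − 2)·∏`» first step of the per-period count). -/

section LayerOne

variable {Y : Set V} {h : V → ℕ} {p : V → V}
  (h0 : ∀ v, h v = 0 ↔ v ∈ Y) (hpar : ∀ v, v ∉ Y → G.Adj v (p v) ∧ h (p v) + 1 = h v)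
  (hchild : ∀ v w, v ∉ Y → G.Adj v w → w ≠ p v → h w = h v + 1 ∧ p w = v)
  {P : V → Prop} (hP : ∀ w, w ∉ Y → (P w ↔ P (p w)))

include h0 hpar hchild hP in
/-- **THE FIRST LAYER above a hereditary predicate**: `#(L_1 ∩ P) = Σ_{y ∈ Y ∩ P} #(N(y) ∖ Y)` (`Y ∩ P` finite). [cite: Serre1980Trees, I.2.3] -/
theorem ncard_layer_one_eq_sum_of_hereditary [DecidableEq V] [DecidablePred (· ∈ Y)] (hD : {v | v ∈ Y ∧ P v}.Finite) :
    {w | h w = 1 ∧ P w}.ncard = ∑ y ∈ hD.toFinset, ((G.neighborFinset y).filter (fun w => w ∉ Y)).card := by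
  have hs : ∀ v, v ∈ hD.toFinset ↔ h v = 0 ∧ P v := fun v => by
    rw [Set.Finite.mem_toFinset, Set.mem_setOf_eq, h0]
  obtain ⟨t, ht, hcard⟩ := exists_finset_layer_succ_of_hereditary h0 hpar hchild hP (k := 0) hs
  have hset : {w | h w = 1 ∧ P w} = (t : Set V) := by
    ext w; rw [Set.mem_setOf_eq, Finset.mem_coe, ht]
  rw [hset, Set.ncard_coe_finset, hcard]
  refine Finset.sum_congr rfl fun y hy => ?_
  have hyY : y ∈ Y := (h0 y).1 ((hs y).1 hy).1
  rw [children_eq_filter_not_mem h0 hpar hchild hyY]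

include h0 hpar hchild hP in
/-- **The first layer, typed**: with a type function `c` (adjacent vertices of different types) and `i ≠ j`, the type-`i` vertices of `L_1 ∩ P` are the children of the type-`j` points of
`Y ∩ P`: `#(L_1 ∩ c⁻¹{i} ∩ P) = Σ_{y ∈ Y ∩ P, c y = j} #(N(y) ∖ Y)`. [cite: Serre1980Trees, I.2.3] -/
theorem ncard_layer_one_inter_type_eq_sum_of_hereditary [DecidableEq V] [DecidablePred (· ∈ Y)] (hD : {v | v ∈ Y ∧ P v}.Finite) (c : V → Fin 2)
    (hc : ∀ v w, G.Adj v w → c v ≠ c w) {i j : Fin 2} (hij : i ≠ j) :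
    {w | h w = 1 ∧ c w = i ∧ P w}.ncard = ∑ y ∈ hD.toFinset.filter (fun y => c y = j), ((G.neighborFinset y).filter (fun w => w ∉ Y)).card := by
  set s : Finset V := hD.toFinset.filter (fun y => c y = j) with hsdef
  have hs : ∀ v, v ∈ s ↔ h v = 0 ∧ c v = j ∧ P v := fun v => by
    rw [hsdef, mem_filter, Set.Finite.mem_toFinset, Set.mem_setOf_eq, h0]
    tauto
  have hother : ∀ v w, G.Adj v w → (c w = i ↔ c v = j) := by
    intro v w hadj
    have hne := hc v w hadj
    constructor
    · intro hwi
      exact fin_two_eq_of_ne_of_ne hij.symm (by rw [← hwi]; exact hne)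
    · intro hvj
      exact fin_two_eq_of_ne_of_ne hij (by rw [← hvj]; exact fun heq => hne heq.symm)
  set t : Finset V := s.biUnion (fun v => (G.neighborFinset v).filter (fun w => h w = h v + 1)) with htdef
  have ht : ∀ w, w ∈ t ↔ h w = 1 ∧ c w = i ∧ P w := by
    intro w
    rw [htdef, mem_biUnion]
    constructor
    · rintro ⟨v, hv, hw⟩
      rw [mem_filter, mem_neighborFinset] at hw
      obtain ⟨hvk, hvj, hvP⟩ := (hs v).1 hv
      have hwY : w ∉ Y := fun hY' => by have := (h0 w).2 hY'; omega
      have hpw : p w = v := parent_eq_of_adj_of_height hchild hwY hw.1.symm hw.2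
      exact ⟨by rw [hw.2, hvk], (hother v w hw.1).2 hvj, (hP w hwY).2 (by rw [hpw]; exact hvP)⟩
    · rintro ⟨hw, hwi, hwP⟩
      have hwY : w ∉ Y := fun hY' => by have := (h0 w).2 hY'; omega
      obtain ⟨hadj, hh⟩ := hpar w hwY
      refine ⟨p w, (hs (p w)).2 ⟨by omega, (hother (p w) w hadj.symm).1 hwi, (hP w hwY).1 hwP⟩, ?_⟩
      rw [mem_filter, mem_neighborFinset]
      exact ⟨hadj.symm, by omega⟩
  have hti : {w | h w = 1 ∧ c w = i ∧ P w} = (t : Set V) := by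
    ext w; rw [Set.mem_setOf_eq, Finset.mem_coe, ht]
  have hcard : t.card = ∑ v ∈ s, ((G.neighborFinset v).filter (fun w => h w = h v + 1)).card := by
    apply card_biUnion
    intro v hv v' hv' hne
    rw [Function.onFun, Finset.disjoint_left]
    intro w hw hw'
    rw [mem_filter, mem_neighborFinset] at hw hw'
    have hwY : w ∉ Y := fun hY' => by
      have := (h0 w).2 hY'
      have := ((hs v).1 hv).1
      omega
    have h1 : p w = v := parent_eq_of_adj_of_height hchild hwY hw.1.symm hw.2
    have h2 : p w = v' := parent_eq_of_adj_of_height hchild hwY hw'.1.symm hw'.2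
    exact hne (h1.symm.trans h2)
  rw [hti, Set.ncard_coe_finset, hcard]
  refine Finset.sum_congr rfl fun y hy => ?_
  have hyY : y ∈ Y := (h0 y).1 ((hs y).1 hy).1
  rw [children_eq_filter_not_mem h0 hpar hchild hyY]

include h0 hpar hchild hP in
/-- **THE CONE BELOW ONE VERTEX**: if `Y ∩ P = {y₀}` (e.g. `P v :=` «the root of `v` is `y₀`»), then `#(L_1 ∩ P) = #(N(y₀) ∖ Y)`; for an inner vertex `y₀` of an axis `Y` this is `deg y₀ − 2`
(`card_neighborFinset_filter_not_mem`). [cite: Serre1980Trees, I.6.4 Prop. 24–25] -/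
theorem ncard_layer_one_eq_of_root [DecidableEq V] [DecidablePred (· ∈ Y)] {y₀ : V} (hD : {v | v ∈ Y ∧ P v} = {y₀}) :
    {w | h w = 1 ∧ P w}.ncard = ((G.neighborFinset y₀).filter (fun w => w ∉ Y)).card := by
  have hDfin : {v | v ∈ Y ∧ P v}.Finite := by rw [hD]; exact Set.finite_singleton y₀
  have hset : hDfin.toFinset = {y₀} := by
    ext v
    rw [Set.Finite.mem_toFinset, hD, Set.mem_singleton_iff, Finset.mem_singleton]
  rw [ncard_layer_one_eq_sum_of_hereditary h0 hpar hchild hP hDfin, hset, Finset.sum_singleton]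

end LayerOne

/-- Bookkeeping: `#(N(y) ∖ Y) = deg y − #(N(y) ∩ Y)` (so `= deg y − 2` for an inner vertex of a path `Y`). [cite: Diestel2010, §1.3] -/
theorem card_neighborFinset_filter_not_mem {Y : Set V} [DecidablePred (· ∈ Y)] (y : V) :
    ((G.neighborFinset y).filter (fun w => w ∉ Y)).card = G.degree y - ((G.neighborFinset y).filter (fun w => w ∈ Y)).card := by
  have := Finset.card_filter_add_card_filter_not (s := G.neighborFinset y) (fun w => w ∈ Y)
  rw [card_neighborFinset_eq_degree] at this
  omega

end Literature.Combinatorics.SimpleGraph.TreeLayers
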